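import Mathlib.LinearAlgebra.Finsupp.LinearCombination
import Mathlib.LinearAlgebra.Quotient.Basic
import Mathlib.LinearAlgebra.Span.Basic
import Mathlib.LinearAlgebra.Basis.Defs
import Mathlib.LinearAlgebra.FreeModule.PID
import Mathlib.LinearAlgebra.Dimension.Free
import Mathlib.GroupTheory.OrderOfElement
import Mathlib.Algebra.EuclideanDomain.Int
import Mathlib.RingTheory.Noetherian.Basic
import Mathlib.RingTheory.PrincipalIdealDomain
import HarnessLib

/-!
# Crux `FrobeniusLadder.FRationalResolution` (stmt-ResolutionOfSingularities-15317), line `redirect`,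
# stub `stub_diagonalizableQuotientResolution` — a LINEAR SECTION of the unit exponents over the sharpened exponent lattice
# (fourth brick of the «sharpening» step for WILD non-fixed points, memo MEMO-15317-leafhand4-g1 §remaining (1))

Generic group bookkeeping, companion of `…SharpProjection` (✓ p825296). Split `ℤᴺ = ℤⁿ ⊕ ℤᵐ` along `e`, degrees `c : Fin N → A`,
`H = ℤ⟨c_{inr j}⟩`, `c♯ i = [c_{inl i}] ∈ A ⧸ H`. On the sharpened exponent LATTICE `K♯ = ker(m ↦ Σ mᵢ c♯ᵢ) = {m : Σ mᵢ c_{inl i} ∈ H}`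
(a subgroup of `ℤⁿ`, hence free) there is a `ℤ`-LINEAR choice of unit exponents `s : K♯ → ℤᵐ` with
`Σ mᵢ c_{inl i} + Σ (s m)ⱼ c_{inr j} = 0` — i.e. `(m, s m) ∈ ker(v ↦ Σ v_l c_l)`: choose the exponents on a `ℤ`-basis of `K♯`
(`Submodule.mem_span_range_iff_exists_fun`) and extend linearly (`Basis.constr`). Downstream this defines the sharpened chart
`ψ♯(m) = y^m · y^{s m}` (a monoid homomorphism because `s` is additive), to which `…LogChartUnitTransfer` / `…SharpRank` apply.

* **`exists_linear_section`** — the statement above.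

Honest label: bookkeeping brick (no stub closed). No definitions, no named facts, no sorry. [folklore; cite: Kato1994, (1.5)]
-/

-- single-problem summit: the doubled namespace component is forced
set_option linter.dupNamespace false

namespace Summit.ResolutionOfSingularities.ResolutionOfSingularities.Theorems.FRationalResolution.SharpSection

universe w

variable {A : Type w} [AddCommGroup A] {N n m : ℕ}

/-- **A linear section of the unit exponents.** For `e : Fin n ⊕ Fin m ≃ Fin N`, `c : Fin N → A`, `H = ℤ⟨c (e (inr j))⟩` and the
lattice `K♯ = ker(m ↦ Σ mᵢ [c (e (inl i))] ∈ A ⧸ H)`, there is a `ℤ`-linear `s : K♯ → ℤᵐ` with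
`Σ mᵢ c (e (inl i)) + Σ (s m)ⱼ c (e (inr j)) = 0` for every `m ∈ K♯`. [folklore; cite: Kato1994, (1.5)] -/
theorem exists_linear_section (e : Fin n ⊕ Fin m ≃ Fin N) (c : Fin N → A) :
    ∃ s : (LinearMap.ker (Fintype.linearCombination ℤ (fun i : Fin n =>
        (Submodule.span ℤ (Set.range fun j : Fin m => c (e (Sum.inr j)))).mkQ (c (e (Sum.inl i)))))) →ₗ[ℤ]
        (Fin m → ℤ),
      ∀ k : LinearMap.ker (Fintype.linearCombination ℤ (fun i : Fin n =>
        (Submodule.span ℤ (Set.range fun j : Fin m => c (e (Sum.inr j)))).mkQ (c (e (Sum.inl i))))),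
        (∑ i, (k : Fin n → ℤ) i • c (e (Sum.inl i))) + ∑ j, s k j • c (e (Sum.inr j)) = 0 := by
  classical
  set H : Submodule ℤ A := Submodule.span ℤ (Set.range fun j : Fin m => c (e (Sum.inr j))) with hH
  set K := LinearMap.ker (Fintype.linearCombination ℤ (fun i : Fin n => H.mkQ (c (e (Sum.inl i))))) with hK
  -- membership in `K♯`: the `inl`-degree lies in `H`
  have hmemK : ∀ k : K, ∑ i, (k : Fin n → ℤ) i • c (e (Sum.inl i)) ∈ H := by
    intro k
    have hk : Fintype.linearCombination ℤ (fun i : Fin n => H.mkQ (c (e (Sum.inl i)))) (k : Fin n → ℤ) = 0 := k.2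
    rw [Fintype.linearCombination_apply] at hk
    have h1 : ∑ i, (k : Fin n → ℤ) i • H.mkQ (c (e (Sum.inl i))) = H.mkQ (∑ i, (k : Fin n → ℤ) i • c (e (Sum.inl i))) := by
      rw [map_sum]
      simp only [map_zsmul]
    rw [h1, Submodule.mkQ_apply, Submodule.Quotient.mk_eq_zero] at hk
    exact hk
  -- `K♯` is free: choose a basis
  haveI : Module.Finite ℤ K := Module.Finite.of_injective K.subtype K.injective_subtype
  haveI : Module.Free ℤ K := Module.free_of_finite_type_torsion_free'
  let b := Module.Free.chooseBasis ℤ K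
  -- unit exponents on the basis vectors
  have hchoice : ∀ t : Module.Free.ChooseBasisIndex ℤ K, ∃ d : Fin m → ℤ,
      ∑ j, d j • c (e (Sum.inr j)) = -∑ i, ((b t : K) : Fin n → ℤ) i • c (e (Sum.inl i)) := fun t =>
    (Submodule.mem_span_range_iff_exists_fun ℤ).mp (H.neg_mem (hmemK (b t)))
  choose d hd using hchoice
  -- extend linearly
  let s : K →ₗ[ℤ] (Fin m → ℤ) := b.constr ℤ d
  refine ⟨s, fun k => ?_⟩
  -- the defect `k ↦ Σ kᵢ c_{inl i} + Σ (s k)ⱼ c_{inr j}` is linear and vanishes on the basis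
  let D : K →ₗ[ℤ] A :=
    { toFun := fun k => (∑ i, (k : Fin n → ℤ) i • c (e (Sum.inl i))) + ∑ j, s k j • c (e (Sum.inr j))
      map_add' := fun x y => by
        simp only [Submodule.coe_add, Pi.add_apply, add_smul, Finset.sum_add_distrib, map_add]
        abel
      map_smul' := fun r x => by
        simp only [Submodule.coe_smul, Pi.smul_apply, smul_eq_mul, mul_smul, ← Finset.smul_sum, map_smul,
          RingHom.id_apply, smul_add] }
  have hD : D = 0 := by
    refine b.ext fun t => ?_
    rw [LinearMap.zero_apply]
    change (∑ i, ((b t : K) : Fin n → ℤ) i • c (e (Sum.inl i))) + ∑ j, s (b t) j • c (e (Sum.inr j)) = 0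
    have hs : s (b t) = d t := by simp [s]
    rw [hs, hd t, add_neg_cancel]
  have := congrArg (fun f : K →ₗ[ℤ] A => f k) hD
  simpa [D] using this

end Summit.ResolutionOfSingularities.ResolutionOfSingularities.Theorems.FRationalResolution.SharpSection
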